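import Summits.KontsevichZagierPeriods.KontsevichZagierPeriods.Theorems.RootDecompQuadraticDescentPair18HomotopyP13

/-! # `RootDecompQuadraticDescentPair18HomotopyP14` — part 14/31 of the mechanical ≤400-line split of `Pair18Homotopy_v14_noguard.lean` (sha256 72e9c8442b4af820…)
Source: decomp-kz lens-6 g9 `Pair18Homotopy.lean` v14 (HOME/decomp-kz-lens-6/g9/, sha256 3dda3232…; critic g4-48/g4-53/g4-56/g5 CLEARED; census pair #18 of crux stmt-KontsevichZagierPeriods-28994: homotopy cells, duplications, inversions, Euler–Landen, arc/angle regions; terminal `pair18_g8strips_of_grid : hEuler → hGrid → hAng4 → (g8 form of #18)`); `#guard_msgs … #print axioms` pins removed for landing.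
Split by census-1 g9 `gen/splitlean.py`: scopes re-opened with their `open`/`variable`/`set_option` context; mathematics and declaration order unchanged. -/

set_option linter.unusedSimpArgs false
noncomputable section
open _root_.Set MvPolynomial
namespace Summit.KontsevichZagierPeriods.RootDecompQuadraticDescent.Pair18Homotopy
open Literature.NumberTheory.Transcendental
open Literature.NumberTheory.Transcendental.KZ (RFun cube)
open Summit.KontsevichZagierPeriods.RootDecompQuadraticDescent.DarkPairs (rel_reflect_rep rel_double)
/-- Auxiliary step `vec2_1` (§2b): vec2 1. [bookkeeping] -/
private theorem vec2_1 (a b : ℝ) : (![a, b] : Fin 2 → ℝ) 1 = b := rfl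

/-- Auxiliary step `vec2_0` (§2b): vec2 0. [bookkeeping] -/
private theorem vec2_0 (a b : ℝ) : (![a, b] : Fin 2 → ℝ) 0 = a := rfl

/-- Auxiliary step `cube2` (§0): cube2. [bookkeeping] -/
private theorem cube2 {x : Fin 2 → ℝ} (hx : x ∈ KZ.cube 2) : (0 ≤ x 0 ∧ x 0 ≤ 1) ∧ (0 ≤ x 1 ∧ x 1 ≤ 1) := ⟨hx 0, hx 1⟩

section Arc
open Literature.ModelTheory.ExponentialFields (IsSemialgebraic isSemialgebraic_setOf_eval_le
  isSemialgebraic_setOf_eval_pos)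

/-- Auxiliary step `SqT_sub`: Sq T sub. [bookkeeping] -/
theorem SqT_sub : SqT ⊆ CL1c.rep.domain := fun _ hz => hz.1
/-- Auxiliary step `TriU7_sub`: Tri U7 sub. [bookkeeping] -/
theorem TriU7_sub : TriU ⊆ N7.rep.domain := fun _ hz => hz.1
/-- Auxiliary step `TriL7_sub`: Tri L7 sub. [bookkeeping] -/
theorem TriL7_sub : TriL ⊆ N7.rep.domain := fun _ hz => hz.1
/-- Auxiliary definition `CL1P`: CL1 P. [bookkeeping] -/
def CL1P : KZ.IntegralRep 2 := CL1c.rep.restrict SqT isSemialgebraic_SqT SqT_sub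
/-- Auxiliary definition `N7U`: N7 U. [bookkeeping] -/
def N7U : KZ.IntegralRep 2 := N7.rep.restrict TriU isSemialgebraic_TriU TriU7_sub
/-- Auxiliary definition `N7L`: N7 L. [bookkeeping] -/
def N7L : KZ.IntegralRep 2 := N7.rep.restrict TriL isSemialgebraic_TriL TriL7_sub
/-- Auxiliary step `TriUP_sub`: Tri UP sub. [bookkeeping] -/
theorem TriUP_sub : TriUP ⊆ N7U.domain := fun _ hz => hz.1
/-- Auxiliary definition `N7UP`: N7 UP. [bookkeeping] -/
def N7UP : KZ.IntegralRep 2 := N7U.restrict TriUP isSemialgebraic_TriUP TriUP_sub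

/-- Auxiliary step `CL1c_P`: CL1c P. [bookkeeping] -/
theorem CL1c_P : KZ.of CL1c.rep - KZ.of CL1P ∈ KZ.relations := by
  refine rel_restrict_null CL1c.rep SqT isSemialgebraic_SqT SqT_sub (MeasureTheory.measure_mono_null ?_ volume_edge1)
  intro z hz
  rw [RFun.rep_domain] at hz
  obtain ⟨hz, hn⟩ := hz
  simp only [SqT, mem_inter_iff, mem_setOf_eq, not_and, not_lt] at hn
  exact le_antisymm (hn hz) (hz 1).1
/-- Auxiliary step `N7U_P`: N7 U P. [bookkeeping] -/
theorem N7U_P : KZ.of N7U - KZ.of N7UP ∈ KZ.relations := by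
  refine rel_restrict_null N7U TriUP isSemialgebraic_TriUP TriUP_sub (MeasureTheory.measure_mono_null ?_ volume_edge1)
  intro z hz
  simp only [N7U, KZ.IntegralRep.domain_restrict] at hz
  obtain ⟨hz, hn⟩ := hz
  simp only [TriUP, TriU, mem_inter_iff, mem_setOf_eq, not_and, not_lt] at hn hz
  exact le_antisymm (hn hz) (hz.1 1).1

/-- the degenerate shear `(c,t) ↦ (tc, t)` on `{t > 0}`: `[CL1c|t>0] ≡ [N7|{w ≤ t, t > 0}]`. -/
theorem CL1P_cov : KZ.of CL1P - KZ.of N7UP ∈ KZ.relations := by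
  let Φ : (Fin 2 → ℝ) → (Fin 2 → ℝ) := fun z => ![z 1 * z 0, z 1]
  let Mz : (Fin 2 → ℝ) → Matrix (Fin 2) (Fin 2) ℝ := fun z => !![z 1, z 0; 0, 1]
  let Φ' : (Fin 2 → ℝ) → (Fin 2 → ℝ) →L[ℝ] (Fin 2 → ℝ) := fun z =>
    LinearMap.toContinuousLinearMap (Matrix.toLin' (Mz z))
  have hΦ'ap : ∀ z w, Φ' z w = ![z 1 * w 0 + z 0 * w 1, w 1] := by
    intro z w; funext i
    fin_cases i <;> simp [Φ', Mz, Matrix.toLin'_apply, Matrix.mulVec, dotProduct, Fin.sum_univ_two]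
  have hdet : ∀ z, (Φ' z).det = z 1 := by
    intro z
    unfold ContinuousLinearMap.det
    simp [Φ', LinearMap.det_toLin', Mz, Matrix.det_fin_two]
  have hdom : N7UP.domain = Φ '' CL1P.domain := by
    simp only [N7UP, N7U, CL1P, KZ.IntegralRep.domain_restrict, RFun.rep_domain]
    ext w
    constructor
    · rintro ⟨⟨hw, hle⟩, hpos⟩
      simp only [mem_setOf_eq] at hle hpos
      have hw0 := (hw 0).1
      have hw1' := (hw 1).2
      refine ⟨![w 0 / w 1, w 1], ⟨?_, ?_⟩, ?_⟩
      · intro i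
        fin_cases i
        · exact ⟨by simpa using div_nonneg hw0 hpos.le, by simpa using (div_le_one hpos).mpr hle⟩
        · simpa using hw 1
      · simpa using hpos
      · funext i
        fin_cases i
        · have key : w 1 * (w 0 / w 1) = w 0 := by field_simp
          simpa [Φ] using key
        · simp [Φ]
    · rintro ⟨z, ⟨hz, hpos⟩, rfl⟩
      simp only [mem_setOf_eq] at hpos
      have hz0 := (hz 0).1
      have hz0' := (hz 0).2
      have hz1 := (hz 1).1
      have hz1' := (hz 1).2
      refine ⟨⟨fun i => ?_, ?_⟩, ?_⟩
      · fin_cases i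
        · exact ⟨by simp [Φ]; positivity, by simp [Φ]; nlinarith⟩
        · simpa [Φ] using hz 1
      · simp only [mem_setOf_eq, Φ, vec2_0, vec2_1, Matrix.cons_val_zero, Matrix.cons_val_one, Matrix.head_cons]
        nlinarith
      · simpa [Φ] using hpos
  refine KZ.changeOfVariablesRel_subset_relations ⟨2, CL1P, N7UP, Φ, Φ', ?_, ?_, ?_, hdom, ?_, rfl⟩
  · have hsd : IsSemialgebraic ℚ CL1P.domain := CL1P.isSemialgebraic_domain
    refine (isSemialgebraicMapOn_iff_forall_holds hsd).mpr fun i => ?_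
    fin_cases i
    · exact (isSemialgebraicFunOn_aeval hsd (X 1 * X 0)).congr fun z _ => by simp [Φ]
    · exact (isSemialgebraicFunOn_aeval hsd (X 1)).congr fun z _ => by simp [Φ]
  · intro z hz
    have h0 : HasFDerivAt (fun w : Fin 2 → ℝ => w 1 * w 0)
        (z 1 • ContinuousLinearMap.proj (R := ℝ) (φ := fun _ : Fin 2 => ℝ) 0 +
          z 0 • ContinuousLinearMap.proj (R := ℝ) (φ := fun _ : Fin 2 => ℝ) 1) z :=
      (hasFDerivAt_apply (𝕜 := ℝ) 1 z).mul (hasFDerivAt_apply (𝕜 := ℝ) 0 z)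
    have h1 : HasFDerivAt (fun w : Fin 2 → ℝ => w 1)
        (ContinuousLinearMap.proj (R := ℝ) (φ := fun _ : Fin 2 => ℝ) 1) z := hasFDerivAt_apply 1 z
    have hpi : HasFDerivAt Φ (Φ' z) z := by
      rw [hasFDerivAt_pi']
      intro i
      fin_cases i
      · have e : (ContinuousLinearMap.proj (R := ℝ) (φ := fun _ : Fin 2 => ℝ) 0).comp (Φ' z) =
            z 1 • ContinuousLinearMap.proj (R := ℝ) (φ := fun _ : Fin 2 => ℝ) 0 +
              z 0 • ContinuousLinearMap.proj (R := ℝ) (φ := fun _ : Fin 2 => ℝ) 1 := by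
          ext w; simp [hΦ'ap]; try ring
        simpa [e, Φ, Function.comp_def] using h0
      · have e : (ContinuousLinearMap.proj (R := ℝ) (φ := fun _ : Fin 2 => ℝ) 1).comp (Φ' z) =
            ContinuousLinearMap.proj (R := ℝ) (φ := fun _ : Fin 2 => ℝ) 1 := by
          ext w; simp [hΦ'ap]
        simpa [e, Φ] using h1
    exact hpi.hasFDerivWithinAt
  · intro z₁ hz₁ z₂ hz₂ heq
    have hp : 0 < z₁ 1 := by
      have := hz₁.2; simpa [CL1P, KZ.IntegralRep.domain_restrict, SqT] using this
    have e1 : z₁ 1 = z₂ 1 := by simpa [Φ] using congrFun heq 1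
    have e0 : z₁ 1 * z₁ 0 = z₂ 1 * z₂ 0 := by simpa [Φ] using congrFun heq 0
    rw [← e1] at e0
    have e0' : z₁ 0 = z₂ 0 := mul_left_cancel₀ hp.ne' e0
    funext i
    fin_cases i
    · exact e0'
    · exact e1
  · intro z hz
    have hz' : z ∈ cube 2 ∧ 0 < z 1 := by
      simpa [CL1P, KZ.IntegralRep.domain_restrict, SqT] using hz
    obtain ⟨h0, h1⟩ := cube2 hz'.1
    have hp := hz'.2
    have ha : (0 : ℝ) < 1 + 7 * z 1 := by linarith
    have hb : (0 : ℝ) < 1 + 7 * z 1 * z 0 := by nlinarith [mul_nonneg h1.1 h0.1]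
    rw [hdet z, abs_of_pos hp]
    simp only [CL1P, N7UP, N7U, KZ.IntegralRep.integrand_restrict, RFun.rep_integrand]
    simp only [CL1c, N7, CL1cDen, N7Den, RFun.fn, Φ, map_add, map_sub, map_mul, map_pow, map_neg, aeval_C, aeval_X, map_one, map_ofNat, eq_ratCast, Rat.cast_one, Rat.cast_ofNat, Rat.cast_div, Rat.cast_neg, vec2_0, vec2_1, Matrix.cons_val_zero, Matrix.cons_val_one, Matrix.head_cons]
    field_simp

/-- swap symmetry of the tensor square `N7`. -/
theorem N7U_cov : KZ.of N7U - KZ.of N7L ∈ KZ.relations := by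
  let Φ : (Fin 2 → ℝ) → (Fin 2 → ℝ) := fun z => ![z 1, z 0]
  let Mz : (Fin 2 → ℝ) → Matrix (Fin 2) (Fin 2) ℝ := fun _ => !![0, 1; 1, 0]
  let Φ' : (Fin 2 → ℝ) → (Fin 2 → ℝ) →L[ℝ] (Fin 2 → ℝ) := fun z =>
    LinearMap.toContinuousLinearMap (Matrix.toLin' (Mz z))
  have hΦ'ap : ∀ z w, Φ' z w = ![w 1, w 0] := by
    intro z w; funext i
    fin_cases i <;> simp [Φ', Mz, Matrix.toLin'_apply, Matrix.mulVec, dotProduct, Fin.sum_univ_two]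
  have hdet : ∀ z, (Φ' z).det = -1 := by
    intro z
    unfold ContinuousLinearMap.det
    simp [Φ', LinearMap.det_toLin', Mz, Matrix.det_fin_two]
  have hdom : N7L.domain = Φ '' N7U.domain := by
    simp only [N7L, N7U, KZ.IntegralRep.domain_restrict, TriL, TriU]
    ext w
    constructor
    · rintro ⟨hw, hle⟩
      simp only [mem_setOf_eq] at hle
      refine ⟨![w 1, w 0], ⟨?_, ?_⟩, ?_⟩
      · intro i
        fin_cases i
        · simpa using hw 1
        · simpa using hw 0
      · simpa using hle
      · funext i
        fin_cases i
        · simp [Φ]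
        · simp [Φ]
    · rintro ⟨z, ⟨hz, hle⟩, rfl⟩
      simp only [mem_setOf_eq] at hle
      refine ⟨fun i => ?_, ?_⟩
      · fin_cases i
        · simpa [Φ] using hz 1
        · simpa [Φ] using hz 0
      · simpa [Φ] using hle
  refine KZ.changeOfVariablesRel_subset_relations ⟨2, N7U, N7L, Φ, Φ', ?_, ?_, ?_, hdom, ?_, rfl⟩
  · have hsd : IsSemialgebraic ℚ N7U.domain := N7U.isSemialgebraic_domain
    refine (isSemialgebraicMapOn_iff_forall_holds hsd).mpr fun i => ?_
    fin_cases i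
    · exact (isSemialgebraicFunOn_aeval hsd (X 1)).congr fun z _ => by simp [Φ]
    · exact (isSemialgebraicFunOn_aeval hsd (X 0)).congr fun z _ => by simp [Φ]
  · intro z hz
    have h0 : HasFDerivAt (fun w : Fin 2 → ℝ => w 1)
        (ContinuousLinearMap.proj (R := ℝ) (φ := fun _ : Fin 2 => ℝ) 1) z := hasFDerivAt_apply 1 z
    have h1 : HasFDerivAt (fun w : Fin 2 → ℝ => w 0)
        (ContinuousLinearMap.proj (R := ℝ) (φ := fun _ : Fin 2 => ℝ) 0) z := hasFDerivAt_apply 0 z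
    have hpi : HasFDerivAt Φ (Φ' z) z := by
      rw [hasFDerivAt_pi']
      intro i
      fin_cases i
      · have e : (ContinuousLinearMap.proj (R := ℝ) (φ := fun _ : Fin 2 => ℝ) 0).comp (Φ' z) =
            ContinuousLinearMap.proj (R := ℝ) (φ := fun _ : Fin 2 => ℝ) 1 := by
          ext w; simp [hΦ'ap]
        simpa [e, Φ] using h0
      · have e : (ContinuousLinearMap.proj (R := ℝ) (φ := fun _ : Fin 2 => ℝ) 1).comp (Φ' z) =
            ContinuousLinearMap.proj (R := ℝ) (φ := fun _ : Fin 2 => ℝ) 0 := by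
          ext w; simp [hΦ'ap]
        simpa [e, Φ] using h1
    exact hpi.hasFDerivWithinAt
  · intro z₁ hz₁ z₂ hz₂ heq
    have e0 : z₁ 1 = z₂ 1 := by simpa [Φ] using congrFun heq 0
    have e1 : z₁ 0 = z₂ 0 := by simpa [Φ] using congrFun heq 1
    funext i
    fin_cases i
    · exact e1
    · exact e0
  · intro z hz
    rw [hdet z]
    simp only [N7U, N7L, KZ.IntegralRep.integrand_restrict, RFun.rep_integrand, abs_neg, abs_one, mul_one]
    simp only [N7, N7Den, RFun.fn, Φ, map_add, map_sub, map_mul, map_pow, map_neg, aeval_C, aeval_X, map_one, map_ofNat, eq_ratCast, Rat.cast_one, Rat.cast_ofNat, Rat.cast_div, Rat.cast_neg, vec2_0, vec2_1, Matrix.cons_val_zero, Matrix.cons_val_one, Matrix.head_cons]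
    ring_nf

/-- Auxiliary step `add_N7`: add N7. [bookkeeping] -/
theorem add_N7 : KZ.of N7.rep - KZ.of N7L - KZ.of N7U ∈ KZ.relations := by
  refine KZ.domainAddRel_subset_relations ⟨2, N7.rep, N7L, N7U, ?_, ?_, fun _ _ => rfl, fun _ _ => rfl, rfl⟩
  · simp only [N7L, N7U, KZ.IntegralRep.domain_restrict, RFun.rep_domain, TriL, TriU]
    ext z
    simp only [mem_union, mem_inter_iff, mem_setOf_eq]
    constructor
    · intro hz
      rcases le_total (z 1) (z 0) with h | h
      · exact Or.inl ⟨hz, h⟩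
      · exact Or.inr ⟨hz, h⟩
    · rintro (⟨hz, _⟩ | ⟨hz, _⟩) <;> exact hz
  · refine MeasureTheory.measure_mono_null ?_ volume_diag
    simp only [N7L, N7U, KZ.IntegralRep.domain_restrict, TriL, TriU]
    rintro z ⟨⟨_, h1⟩, ⟨_, h2⟩⟩
    simp only [mem_setOf_eq] at h1 h2 ⊢
    exact le_antisymm h2 h1

/-- Auxiliary step `N49_N7`: N49 N7. [bookkeeping] -/
theorem N49_N7 : KZ.of N49.rep - 2 • KZ.of N7.rep ∈ KZ.relations := by
  refine rel_nsmul 2 N49 N7 fun z hz => ?_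
  simp only [N49, N7, N7Den, RFun.fn, Nat.cast_ofNat, map_add, map_sub, map_mul, map_pow, map_neg, aeval_C, aeval_X, map_one, map_ofNat, eq_ratCast, Rat.cast_one, Rat.cast_ofNat, Rat.cast_div, Rat.cast_neg, vec2_0, vec2_1, Matrix.cons_val_zero, Matrix.cons_val_one, Matrix.head_cons]
  ring

/-- `4•[CL1] ≡ [N49]`. -/
theorem CL1_N49 : KZ.of N49.rep - 4 • KZ.of CL1.rep ∈ KZ.relations := by
  have e : KZ.of N49.rep - 4 • KZ.of CL1.rep = (KZ.of N49.rep - 2 • KZ.of N7.rep)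
      + 2 • ((KZ.of N7.rep - KZ.of N7L - KZ.of N7U) - (KZ.of N7U - KZ.of N7L))
      - 4 • ((KZ.of CL1.rep - KZ.of CL1c.rep) + (KZ.of CL1c.rep - KZ.of CL1P) + (KZ.of CL1P - KZ.of N7UP)
          - (KZ.of N7U - KZ.of N7UP)) := by abel
  rw [e]
  exact sub_mem (add_mem N49_N7 (nsmul_mem (sub_mem add_N7 N7U_cov) 2))
    (nsmul_mem (sub_mem (add_mem (add_mem CL1_sq CL1c_P) CL1P_cov) N7U_P) 4)

/-- swap on the full square: `[T] ≡ [S]` when `T(x,y) = S(y,x)`. -/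
theorem rel_swap (T S : RFun 2) (h : ∀ z ∈ cube 2, T.fn z = S.fn ![z 1, z 0]) :
    KZ.of T.rep - KZ.of S.rep ∈ KZ.relations := by
  let Φ : (Fin 2 → ℝ) → (Fin 2 → ℝ) := fun z => ![z 1, z 0]
  let Mz : (Fin 2 → ℝ) → Matrix (Fin 2) (Fin 2) ℝ := fun _ => !![0, 1; 1, 0]
  let Φ' : (Fin 2 → ℝ) → (Fin 2 → ℝ) →L[ℝ] (Fin 2 → ℝ) := fun z =>
    LinearMap.toContinuousLinearMap (Matrix.toLin' (Mz z))
  have hΦ'ap : ∀ z w, Φ' z w = ![w 1, w 0] := by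
    intro z w; funext i
    fin_cases i <;> simp [Φ', Mz, Matrix.toLin'_apply, Matrix.mulVec, dotProduct, Fin.sum_univ_two]
  have hdet : ∀ z, (Φ' z).det = -1 := by
    intro z
    unfold ContinuousLinearMap.det
    simp [Φ', LinearMap.det_toLin', Mz, Matrix.det_fin_two]
  have hdom : S.rep.domain = Φ '' T.rep.domain := by
    rw [RFun.rep_domain, RFun.rep_domain]
    ext w
    constructor
    · intro hw
      refine ⟨![w 1, w 0], ?_, ?_⟩
      · intro i
        fin_cases i
        · simpa using hw 1
        · simpa using hw 0
      · funext i
        fin_cases i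
        · simp [Φ]
        · simp [Φ]
    · rintro ⟨z, hz, rfl⟩
      intro i
      fin_cases i
      · simpa [Φ] using hz 1
      · simpa [Φ] using hz 0
  refine KZ.changeOfVariablesRel_subset_relations ⟨2, T.rep, S.rep, Φ, Φ', ?_, ?_, ?_, hdom, ?_, rfl⟩
  · refine (isSemialgebraicMapOn_iff_forall_holds T.rep.isSemialgebraic_domain).mpr fun i => ?_
    fin_cases i
    · exact (isSemialgebraicFunOn_aeval T.rep.isSemialgebraic_domain (X 1)).congr fun z _ => by simp [Φ]
    · exact (isSemialgebraicFunOn_aeval T.rep.isSemialgebraic_domain (X 0)).congr fun z _ => by simp [Φ]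
  · intro z hz
    have h0 : HasFDerivAt (fun w : Fin 2 → ℝ => w 1)
        (ContinuousLinearMap.proj (R := ℝ) (φ := fun _ : Fin 2 => ℝ) 1) z := hasFDerivAt_apply 1 z
    have h1 : HasFDerivAt (fun w : Fin 2 → ℝ => w 0)
        (ContinuousLinearMap.proj (R := ℝ) (φ := fun _ : Fin 2 => ℝ) 0) z := hasFDerivAt_apply 0 z
    have hpi : HasFDerivAt Φ (Φ' z) z := by
      rw [hasFDerivAt_pi']
      intro i
      fin_cases i
      · have e : (ContinuousLinearMap.proj (R := ℝ) (φ := fun _ : Fin 2 => ℝ) 0).comp (Φ' z) =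
            ContinuousLinearMap.proj (R := ℝ) (φ := fun _ : Fin 2 => ℝ) 1 := by
          ext w; simp [hΦ'ap]
        simpa [e, Φ] using h0
      · have e : (ContinuousLinearMap.proj (R := ℝ) (φ := fun _ : Fin 2 => ℝ) 1).comp (Φ' z) =
            ContinuousLinearMap.proj (R := ℝ) (φ := fun _ : Fin 2 => ℝ) 0 := by
          ext w; simp [hΦ'ap]
        simpa [e, Φ] using h1
    exact hpi.hasFDerivWithinAt
  · intro z₁ hz₁ z₂ hz₂ heq
    have e0 : z₁ 1 = z₂ 1 := by simpa [Φ] using congrFun heq 0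
    have e1 : z₁ 0 = z₂ 0 := by simpa [Φ] using congrFun heq 1
    funext i
    fin_cases i
    · exact e1
    · exact e0
  · intro z hz
    rw [hdet z, RFun.rep_integrand, RFun.rep_integrand, abs_neg, abs_one, mul_one]
    exact h z hz

/-- Auxiliary step `N7b_CL2`: N7b CL2. [bookkeeping] -/
theorem N7b_CL2 : KZ.of N7b.rep - KZ.of CL2.rep ∈ KZ.relations := by
  refine rel_swap N7b CL2 fun z hz => ?_
  simp only [N7b, CL2, N7bDen, CL2Den, RFun.fn, map_add, map_sub, map_mul, map_pow, map_neg, aeval_C, aeval_X, map_one, map_ofNat, eq_ratCast, Rat.cast_one, Rat.cast_ofNat, Rat.cast_div, Rat.cast_neg, vec2_0, vec2_1, Matrix.cons_val_zero, Matrix.cons_val_one, Matrix.head_cons]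
  try rw [mul_comm]

end Arc
end Summit.KontsevichZagierPeriods.RootDecompQuadraticDescent.Pair18Homotopy
end
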